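import Literature.NumberTheory.Sieve.PolymathProductLatticeBounds
import HarnessLib

/-!
# Log-free (midpoint-rule) lower bounds for the primitive of Polymath 8b's profile `1/(c+(k-1)t)`

Topic `Literature/NumberTheory/Sieve`; companion of `PolymathProductLatticeBounds.lean` (route
`MaynardProductExact`, crux MkCert).  The numerator weights of
`Literature.NumberTheory.Sieve.MaynardTao.maynardFunctional_polymathProfile_ge_lattice` are values of the
primitive `∫_{(0,Jh]} polymathProfile k c T = (1/(k-1)) log((c+(k-1)Jh)/c)` — transcendental.  Since
`t ↦ 1/(c+κt)` is convex, the MIDPOINT rule under-estimates each cell integral (the first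
Hermite–Hadamard inequality `f((a+b)/2) ≤ (1/(b-a)) ∫_a^b f`, Cerone–Dragomir §2.1 (2.1); for `f(x) = 1/x`
it is the logarithmic–arithmetic means inequality `L(a,b) ≤ A(a,b)`, a special case of (2.15)), so the primitive is bounded BELOW by a
rational prefix sum `h·∑_{j<J} 1/(c+κ(j+½)h)`.  A kernel certificate can therefore use dyadically
rounded-down prefix sums as weights — no certified logarithms.  The one analytic input is the atanh
bound `2x ≤ log(1+x) - log(1-x)` (first term of Mathlib's `Real.hasSum_log_sub_log_of_abs_lt_one`).

Statements as drafted by the parity-ideate cell (p3 g4, `route4/MidpointLowerBound.lean`, LIT-REQ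
2026-08-26T04:47:55Z), vendored with citations; no new named facts.

## References
* [CeroneDragomir2010] P. Cerone, S. S. Dragomir, *Mathematical Inequalities: A Perspective*, CRC Press
  (2010), Ch. 2 §2.1, the Hermite–Hadamard integral inequality (2.1), p. 55; §2.2 (2.15) (the means
  inequality `0 ≤ (A − L)/L`, logarithmic vs. arithmetic mean, i.e. (2.1) for `f(x) = 1/x`).
* [Polymath8b2014] D. H. J. Polymath, *Variants of the Selberg sieve, and bounded intervals containing
  many primes*, Res. Math. Sci. 1:12 (2014), proof of Theorem 6.7 (the profile `g(t) = 1/(c+(k-1)t)`,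
  p. 25).
-/

noncomputable section

open Real Finset MeasureTheory Set

namespace Literature.NumberTheory.Sieve

namespace MaynardTao

/-- `2x ≤ log(1+x) − log(1−x)` for `0 ≤ x < 1` (all terms of the series
`log((1+x)/(1-x)) = 2∑ x^{2k+1}/(2k+1)` are nonnegative). [folklore] -/
private theorem two_mul_le_log_sub_log {x : ℝ} (h0 : 0 ≤ x) (h1 : x < 1) :
    2 * x ≤ Real.log (1 + x) - Real.log (1 - x) := by
  have habs : |x| < 1 := abs_lt.2 ⟨by linarith, h1⟩
  have hs := Real.hasSum_log_sub_log_of_abs_lt_one habs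
  have hle := sum_le_hasSum (Finset.range 1)
    (fun k _ => mul_nonneg (mul_nonneg (by norm_num) (by positivity)) (pow_nonneg h0 _)) hs
  simpa using hle

/-- **Hermite–Hadamard (midpoint) lower bound on one lattice cell of the convex function `1/(c+κt)`**:
`h/(c+κ(j+½)h) ≤ (1/κ)·log((c+κ(j+1)h)/(c+κjh))`, i.e. `f((a+b)/2)·(b−a) ≤ ∫_a^b f` for `f(t) = 1/(c+κt)`,
`[a,b] = [jh,(j+1)h]` — equivalently the logarithmic–arithmetic means inequality `L ≤ A` for the
endpoint values. [cite: CeroneDragomir2010, Ch. 2 §2.1 inequality (2.1) (first inequality); §2.2 (2.15) (L ≤ A, the case f(x) = 1/x)] -/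
theorem midpoint_le_log_cell {c κ h : ℝ} (hc : 0 < c) (hκ : 0 < κ) (hh : 0 ≤ h) (j : ℕ) :
    h * (1 / (c + κ * ((j + 1 / 2) * h))) ≤
      1 / κ * Real.log ((c + κ * ((j + 1) * h)) / (c + κ * (j * h))) := by
  have hjh : (0:ℝ) ≤ j * h := by positivity
  have hA : 0 < c + κ * ((j + 1 / 2) * h) := by positivity
  have hlo : 0 < c + κ * (j * h) := by positivity
  have hhi : 0 < c + κ * ((j + 1) * h) := by positivity
  -- u = κh / (2A)
  have hu0 : 0 ≤ κ * h / (2 * (c + κ * ((j + 1 / 2) * h))) := by positivity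
  have hu1 : κ * h / (2 * (c + κ * ((j + 1 / 2) * h))) < 1 := by
    rw [div_lt_one (by positivity)]
    nlinarith [mul_nonneg hκ.le hjh, mul_nonneg hκ.le hh]
  have hlog := two_mul_le_log_sub_log hu0 hu1
  have h1u : 1 + κ * h / (2 * (c + κ * ((j + 1 / 2) * h))) =
      (c + κ * ((j + 1) * h)) / (c + κ * ((j + 1 / 2) * h)) := by
    field_simp
    ring
  have h1u' : 1 - κ * h / (2 * (c + κ * ((j + 1 / 2) * h))) =
      (c + κ * (j * h)) / (c + κ * ((j + 1 / 2) * h)) := by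
    field_simp
    ring
  rw [h1u, h1u', Real.log_div hhi.ne' hA.ne', Real.log_div hlo.ne' hA.ne'] at hlog
  rw [Real.log_div hhi.ne' hlo.ne']
  have hid : h * (1 / (c + κ * ((j + 1 / 2) * h))) =
      1 / κ * (2 * (κ * h / (2 * (c + κ * ((j + 1 / 2) * h))))) := by
    field_simp
  rw [hid]
  exact mul_le_mul_of_nonneg_left (by linarith) (by positivity)

/-- **Composite midpoint rule under-estimates the primitive of the convex profile**:
`h·∑_{j<J} 1/(c+κ(j+½)h) ≤ (1/κ)·log((c+κJh)/c)` (sum of the cellwise Hermite–Hadamard inequalities).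
[cite: CeroneDragomir2010, Ch. 2 §2.1 inequality (2.1) (first inequality), summed over the cells [jh,(j+1)h]] -/
theorem sum_midpoint_le_log {c κ h : ℝ} (hc : 0 < c) (hκ : 0 < κ) (hh : 0 ≤ h) (J : ℕ) :
    h * ∑ j ∈ Finset.range J, 1 / (c + κ * ((j + 1 / 2) * h)) ≤
      1 / κ * Real.log ((c + κ * (J * h)) / c) := by
  induction J with
  | zero => simp
  | succ J ih =>
    rw [Finset.sum_range_succ, mul_add]
    have hcell := midpoint_le_log_cell hc hκ hh J
    have hlo : 0 < c + κ * (J * h) := by positivity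
    have hhi : 0 < c + κ * ((J + 1) * h) := by positivity
    have hsplit : Real.log ((c + κ * (((J + 1 : ℕ) : ℝ) * h)) / c) =
        Real.log ((c + κ * (J * h)) / c) + Real.log ((c + κ * ((J + 1) * h)) / (c + κ * (J * h))) := by
      rw [← Real.log_mul (div_pos hlo hc).ne' (div_pos hhi hlo).ne']
      push_cast
      congr 1
      field_simp
    rw [hsplit, mul_add]
    exact add_le_add ih hcell

/-- **The weight bound in the tree's vocabulary** (route `MaynardProductExact`, crux MkCert): for a lattice
point `J·h ≤ T`, `h·∑_{j<J} 1/(c+(k−1)(j+½)h) ≤ ∫_{(0, Jh]} polymathProfile k c T` — the numerator weights of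
`maynardFunctional_polymathProfile_ge_lattice` (values of the primitive of Polymath 8b's profile
`g(t) = 1/(c+(k-1)t)`, Theorem 6.7) are bounded below by RATIONAL midpoint prefix sums, so the kernel
certificate needs no certified logarithms. [cite: Polymath8b2014, proof of Theorem 6.7 (the profile g(t) = 1/(c+(k-1)t)); CeroneDragomir2010, Ch. 2 §2.1 (2.1)] -/
theorem sum_midpoint_le_setIntegral_polymathProfile {k : ℕ} (hk : 2 ≤ k) {c T h : ℝ} (hc : 0 < c)
    (hT : 0 < T) (hh : 0 ≤ h) {J : ℕ} (hJ : (J : ℝ) * h ≤ T) :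
    h * ∑ j ∈ Finset.range J, 1 / (c + ((k:ℝ) - 1) * ((j + 1 / 2) * h)) ≤
      ∫ u in Ioc 0 ((J:ℝ) * h), polymathProfile k c T u := by
  have hκ : (0:ℝ) < (k:ℝ) - 1 := by
    have : (2:ℝ) ≤ k := by exact_mod_cast hk
    linarith
  have hx : (0:ℝ) ≤ (J:ℝ) * h := by positivity
  rw [setIntegral_Ioc_polymathProfile hk hc hT, max_eq_left hx, min_eq_left hJ]
  exact sum_midpoint_le_log hc hκ hh J

end MaynardTao

end Literature.NumberTheory.Sieve
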